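import Summits.BirchSwinnertonDyer.BirchSwinnertonDyer.Theorems.ByReductionTypeAtTwoSupersingularFlatRoadLineV9
import Summits.BirchSwinnertonDyer.BirchSwinnertonDyer.Theorems.ByReductionTypeAtTwoSupersingularFlatClass100925b
import HarnessLib

/-!
# The ♭ class door and integer-model kit with the ♭ `Γ`-Euler characteristic at `2` DISCHARGED (Honda₂
# clauses + ONE count instead of the EC♭ binder), and the first class instance in that currency (`100925b`)

Seat `bsd-2adic-ss-1` GEN 10, crux `SupersingularRankZeroAtTwo` (item stmt-BirchSwinnertonDyer-19097, route
`ByReductionTypeAtTwo`, rung K4), `a₂ = ±2` sub-row (549 r0 classes; GEN 9's class side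
`Theorems/ByReductionTypeAtTwoSupersingularFlatClass<cls>.lean` displays, for ARBITRARY supplied local data
`(κ, γ, ι, g, c)`, the READ-AT-2 binders {EC♭, CK♭}). WHAT: the same door / kit with `ι = closureEmb ℚ_v`
(`v ∋ 2`), `g` a local lift of `γ`, and the binder EC♭ REPLACED by what PRODUCES it in the kernel
(`SSFlatRoad.flatEulerChar_two`, GEN 10): the Honda₂ clauses of the data — levels `c_n ∈ E(ℚ_{2,n})`, the
`n ≥ 1` trace relation with `a₂`, the level-`0` generation clause ON `c_0` (injective + `2`-saturated) — and
ONE count (Sprung 2024 Lemma 5.5 READ AT 2 on Sel♭: `#(A♭_0/Sel_0)·#E[2^∞]^{Γ_ℚ} = 2^{ord₂∏c_ℓ}·#(Sel♭_∞)_γ`).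
* `bsdp_two_of_flatCountColemanKato_of_pow_dvd` — the door (per curve);
* `bsdp_two_baseChange_int_of_flatCountColemanKato` — the integer-model kit (one-line class targets, same
  kernel-decided inputs as `bsdp_two_baseChange_int_of_flatColemanKato`);
* `bsdp_two_100925b1_of_flatCountColemanKato` — the class `100925b` (`a₂ = 2`, `N = 100925`,
  `100925b1 = [0, 1, 1, −213157158, 17550889390969]`) re-displayed in the new currency, re-using the landed
  class file's kernel-decided lemmas (`M100925b1_Δ`, `M100925b1_c₄`, `M100925b1_b`, `card_F2_100925b1`).
Displayed binders after this file: PRINT {`hmod`, `hGZK`, `h124`, `hX0`, `hDD`}; PRINT-at-2/DERIVED {Honda₂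
clauses on the supplied `c` (Sprung 2012 Thm. 2.2 (2′) traced; gen₀ on `d_0 = [−c♭]ε`)}; READ-AT-2 {COUNT♭@2,
CK♭@2}; CERT {`L(E,1) ≠ 0`, `#Ш_an = Q`, `2^m ∣ #Ш`}. HONEST FRAMING: class-instance shapes; closes nothing
by itself; no census cell moves; BSD is not proved by any of this. The other 548 class files convert by the
same one-token template change (generator `ss/classes/flat/gen_flat.py`) when the cell wants the re-display.

References: [Sprung2024] §5.2 Lemmas 5.5–5.9; [Sprung2012] Thm. 2.2 (2′), Lemma 2.3, Def. 7.2, Prop. 7.3,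
Thm. 7.14, 7.16, Prop. 7.19; [Kato2004Asterisque] Thm. 12.4–12.5; [KuriharaOtsuki2006] p. 564;
[DokchitserDokchitserMathZ2012] Theorem; [SilvermanAEC2009] VII.5 Prop. 5.1(a); [Miller2011LMS] Def. 1.1;
[CremonaAlgorithms1997] Table 1 (100925b1).
-/

set_option autoImplicit false
-- the Theorems namespace of this sub repeats the summit name by design (D-0017 nested layout)
set_option linter.dupNamespace false

noncomputable section

open scoped Classical MatrixGroups ModularForm NumberField
open NumberField IsDedekindDomain CongruenceSubgroup WeierstrassCurve Literature.NumberTheory.EllipticCurves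
  Literature.NumberTheory.EllipticCurves.ModularForms Literature.NumberTheory.EllipticCurves.Sprung2017
  Literature.NumberTheory.EllipticCurves.Rank1Residual Literature.NumberTheory.EllipticCurves.Rank1Residual.Typed
  Literature.NumberTheory.EllipticCurves.Sprung2012 Literature.NumberTheory.EllipticCurves.IwasawaDual
  Literature.NumberTheory.EllipticCurves.Kobayashi2003 Literature.NumberTheory.GaloisRepresentations
  ZpExtension Summit.BirchSwinnertonDyer.Rank1Residual Summit.BirchSwinnertonDyer.Rank1Residual.Supersingular
  Summit.BirchSwinnertonDyer.Rank1Residual.X5 Summit.BirchSwinnertonDyer.Rank1Residual.X5.O1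
  Summit.BirchSwinnertonDyer.Rank1Residual.X5.Instances

namespace Summit.BirchSwinnertonDyer.BirchSwinnertonDyer.Theorems
namespace SSFlatRoad

/-! ## §1 The door with EC♭ discharged -/

/-- **`BSD(E, 2)` on the ♭ Coleman road with the ♭ `Γ`-Euler characteristic PRODUCED** — the door
`bsdp_two_of_flatColemanKato_of_pow_dvd` at `ι = closureEmb ℚ_v` (`v ∋ 2`), `g` a local lift of `γ`, with
its binder `hEC` replaced by the Honda₂ clauses of `c` (`hc`, `hTr`, `hinj`, `hsat`) and the count `hcount`
(`SSFlatRoad.flatEulerChar_two`). PUB {`hmod`, `hGZK`, `h124`, `hX0`}; `TwoAdicSurjective W`; CK♭ (`hCK`);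
CERT {`L(E,1) ≠ 0`, `#Ш_an = q`, `v₂ q ≤ m`, `2^m ∣ #Ш`}. Any `a₂ ∈ {0, ±2}`.
[cite: Sprung2024, §5.2 Lemmas 5.5–5.9] [cite: Sprung2012, Thm. 2.2 (2′), Lemma 2.3, Prop. 7.3, Thm. 7.14, 7.16]
[cite: Kato2004Asterisque, Thm. 12.4–12.5] [cite: KuriharaOtsuki2006, p. 564] [cite: Miller2011LMS, Def. 1.1] -/
theorem bsdp_two_of_flatCountColemanKato_of_pow_dvd (W : WeierstrassCurve ℚ) [W.IsElliptic] [W.IsGloballyMinimal]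
    {κ : ZpExtension ℚ 2} {γ : Field.absoluteGaloisGroup ℚ} {v : HeightOneSpectrum (𝓞 ℚ)}
    (g : Field.absoluteGaloisGroup (v.adicCompletion ℚ)) (c : ℕ → localPoints W (v.adicCompletion ℚ))
    (hmod : nonempty_modularParametrizationData)
    (hGZK : rank_eq_analyticRank_of_analyticRank_le_one)
    (h124 : Kato2004.thm12_4) (hX0 : Kato2004_fineSelmerDual_isTorsion)
    (hgood : W.HasGoodReductionAtPrime 2) (hss : (2 : ℤ) ∣ W.frobeniusTrace 2)
    (hL : W.entireLFunction 1 ≠ 0)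
    (hκ : κ.IsCyclotomic) (hγ : κ.IsTopGenerator γ) (hsurj : TwoAdicSurjective W)
    (hv : (2 : 𝓞 ℚ) ∈ v.asIdeal)
    (hg : κ.IsTopGenerator (resGalOfEmb (closureEmb (K := ℚ) (v.adicCompletion ℚ)) g))
    (hc : ∀ n, c n ∈ localLayerPointsOfEmb κ (closureEmb (K := ℚ) (v.adicCompletion ℚ)) W n)
    (hTr : ∀ n, 1 ≤ n → localTraceOfEmb κ (closureEmb (K := ℚ) (v.adicCompletion ℚ)) W n (n + 1)
      (c (n + 1)) = W.frobeniusTrace 2 • c n - c (n - 1))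
    (hinj : ∀ z₀ : localLayerPointsOfEmb κ (closureEmb (K := ℚ) (v.adicCompletion ℚ)) W 0 →+ ℤ_[2],
      evalOn W (localLayerPointsOfEmb κ (closureEmb (K := ℚ) (v.adicCompletion ℚ)) W 0) z₀ (c 0) = 0 →
        z₀ = 0)
    (hsat : ∀ a : ℤ_[2],
      (∃ z₀ : localLayerPointsOfEmb κ (closureEmb (K := ℚ) (v.adicCompletion ℚ)) W 0 →+ ℤ_[2],
        evalOn W (localLayerPointsOfEmb κ (closureEmb (K := ℚ) (v.adicCompletion ℚ)) W 0) z₀ (c 0) =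
          2 * a) →
      ∃ y : localLayerPointsOfEmb κ (closureEmb (K := ℚ) (v.adicCompletion ℚ)) W 0 →+ ℤ_[2],
        evalOn W (localLayerPointsOfEmb κ (closureEmb (K := ℚ) (v.adicCompletion ℚ)) W 0) y (c 0) = a)
    (hcount : Finite (W.selmerGroupPInfty 2) →
      Finite (EndCoinvariants (conjSharpFlatSelmerInfty W κ (closureEmb (K := ℚ) (v.adicCompletion ℚ))
        (W.frobeniusTrace 2) g c .flat γ - 1)) →
      Nat.card (↥((sharpFlatSelmerInfty W κ (closureEmb (K := ℚ) (v.adicCompletion ℚ))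
            (W.frobeniusTrace 2) g c .flat).comap (W.layerToInfty κ 0)) ⧸
          (W.selmerLayer κ 0).addSubgroupOf
            ((sharpFlatSelmerInfty W κ (closureEmb (K := ℚ) (v.adicCompletion ℚ))
              (W.frobeniusTrace 2) g c .flat).comap (W.layerToInfty κ 0))) *
        Nat.card (MulAction.fixedPoints (Field.absoluteGaloisGroup ℚ) (W.geomPrimaryTorsion 2)) =
      2 ^ (padicValNat 2 W.tamagawaProduct) *
        Nat.card (EndCoinvariants (conjSharpFlatSelmerInfty W κ
          (closureEmb (K := ℚ) (v.adicCompletion ℚ)) (W.frobeniusTrace 2) g c .flat γ - 1)))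
    (hCK : ∀ [NeZero (W.conductorNorm ℤ)] (f : CuspForm (Gamma0 (W.conductorNorm ℤ)) 2),
        IsNewformOf W f → ∀ (ϖ : ℚ), (ϖ : ℝ) * W.realPeriodRat = plusPeriod f →
      ∀ (Ls Lf : IwasawaAlgebra 2), IsSprungPair f 2 (W.frobeniusTrace 2) Ls Lf →
      ∀ (D : SharpFlatSelmerDualData W κ γ (closureEmb (K := ℚ) (v.adicCompletion ℚ))
          (W.frobeniusTrace 2) g c .flat)
        [ContinuousSMul ℤ_[2] (W.tateModule 2)],
        ∃ (I : Kato2004.IwasawaH1Data W 2 κ γ) (Y : W.FineSelmerDualData κ γ)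
          (P : Submodule (IwasawaAlgebra 2) (IwasawaAlgebra 2))
          (loc : I.H →ₗ[IwasawaAlgebra 2] P) (toX : P →ₗ[IwasawaAlgebra 2] D.X)
          (δ : D.X →ₗ[IwasawaAlgebra 2] Y.X) (Z : Submodule (IwasawaAlgebra 2) I.H)
          (G : IwasawaAlgebra 2),
          Function.Exact loc toX ∧ Function.Exact toX δ ∧
          G ∈ Submodule.map (P.subtype ∘ₗ loc) Z ∧
          iwasawaToPowerSeries 2 G = PowerSeries.C (ϖ : ℚ_[2]) * iwasawaToPowerSeries 2 Lf ∧
          (∀ 𝔭 : PrimeSpectrum (IwasawaAlgebra 2), 𝔭.asIdeal.height = 1 →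
            PowerSeries.C (2 : ℤ_[2]) ∉ 𝔭.asIdeal →
            Literature.NumberTheory.EllipticCurves.Module.lengthAt (IwasawaAlgebra 2) Y.X 𝔭 ≤
              Literature.NumberTheory.EllipticCurves.Module.lengthAt (IwasawaAlgebra 2) (I.H ⧸ Z) 𝔭) ∧
          (TwoAdicSurjective W →
            ∀ 𝔭 : PrimeSpectrum (IwasawaAlgebra 2), 𝔭.asIdeal.height = 1 →
              PowerSeries.C (2 : ℤ_[2]) ∈ 𝔭.asIdeal →
              Literature.NumberTheory.EllipticCurves.Module.lengthAt (IwasawaAlgebra 2) Y.X 𝔭 ≤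
                Literature.NumberTheory.EllipticCurves.Module.lengthAt (IwasawaAlgebra 2) (I.H ⧸ Z) 𝔭))
    {q : ℚ} (hq : shaAn W = (q : ℂ)) {m : ℕ} (hvq : padicValRat 2 q ≤ m)
    (hdvd : 2 ^ m ∣ W.shaOrder) : BSDp W 2 :=
  bsdp_two_of_flatColemanKato_of_pow_dvd W (closureEmb (K := ℚ) (v.adicCompletion ℚ)) g c hmod hGZK h124 hX0
    hgood hss hL hκ hγ hsurj
    (fun D _ hX f hf hfin ↦ flatEulerChar_two W ⟨hgood, hss⟩ κ hγ hv hg hc hTr hinj hsat hcount D hX f hf hfin)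
    hCK hq hvq hdvd

/-! ## §2 The integer-model kit with EC♭ discharged -/

/-- **`BSD(E, 2)` for `E = M ⊗ ℚ` ON THE ♭ COLEMAN ROAD, EC♭ DISCHARGED** — the class-instance shape of crux
`SupersingularRankZeroAtTwo` on the `a₂ = ±2`, `2`-adically surjective classes: the kit
`bsdp_two_baseChange_int_of_flatColemanKato` with the local data specialised to `ι = closureEmb ℚ_v`
(`v ∋ 2`), `g` a local lift of `γ`, and the READ-AT-2 binder EC♭ replaced by the Honda₂ clauses of `c` and the
count. KERNEL inputs (decided per class on literals) unchanged: `Δ(M) = D` odd, `c₄(M) = C4`, `b`'s,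
`#M̃(𝔽₂) = k ∈ {1, 5}`, `C4³/D = n/d`, Dokchitser–Dokchitser certificates `ℓ₁…ℓ₄`, `2^(m+1) ∤ Q`.
DISPLAYED: PRINT {`hmod`, `hGZK`, `h124`, `hX0`, `hDD`}; for the supplied `(κ, γ, v, g, c)`: PRINT-at-2/DERIVED
{levels, trace (`n ≥ 1`), gen₀(`c_0`)}; READ-AT-2 {COUNT♭@2, CK♭@2}; CERT {`L(E,1) ≠ 0`, `#Ш_an = Q`,
`2^m ∣ #Ш`}. Closes nothing by itself. [cite: Sprung2024, §5.2 Lemmas 5.5–5.9]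
[cite: Sprung2012, Thm. 2.2 (2′), Lemma 2.3, Prop. 7.3, Thm. 7.14, 7.16 and Prop. 7.19]
[cite: Kato2004Asterisque, Thm. 12.4–12.5] [cite: KuriharaOtsuki2006, p. 564]
[cite: DokchitserDokchitserMathZ2012, Theorem] [cite: SilvermanAEC2009, VII.5 Prop. 5.1(a)] [cite: Miller2011LMS, Def. 1.1] -/
theorem bsdp_two_baseChange_int_of_flatCountColemanKato (M : WeierstrassCurve ℤ)
    {B₂ B₄ B₆ D C4 n d : ℤ} (hb₂ : M.b₂ = B₂) (hb₄ : M.b₄ = B₄) (hb₆ : M.b₆ = B₆) (hΔ : M.Δ = D)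
    (hc₄ : M.c₄ = C4) (h2 : ¬ (2 : ℤ) ∣ D)
    {k : ℕ} (hcard : Nat.card (M.map (Int.castRingHom (ZMod 2))).toAffine.Point = k) (hk : k = 1 ∨ k = 5)
    (hd : d ≠ 0) (hnd : (C4 : ℚ) ^ 3 / (D : ℚ) = (n : ℚ) / (d : ℚ))
    {ℓ₁ ℓ₂ ℓ₃ ℓ₄ : ℕ} (hℓ₄ : 1 < ℓ₄)
    (h₁ : ∀ r : ZMod ℓ₁,
      r ^ 3 + (B₂ : ZMod ℓ₁) * r ^ 2 + ((8 * B₄ : ℤ) : ZMod ℓ₁) * r + ((16 * B₆ : ℤ) : ZMod ℓ₁) ≠ 0)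
    (h₂ : ∀ r : ZMod ℓ₂, r * r ≠ ((|D| : ℤ) : ZMod ℓ₂))
    (h₃ : ∀ r : ZMod ℓ₃, r * r ≠ ((2 * |D| : ℤ) : ZMod ℓ₃))
    (h₄ : ∀ a b : ZMod ℓ₄, (a ≠ 0 ∨ b ≠ 0) →
      4 * (d : ZMod ℓ₄) * a ^ 4 + 32 * (d : ZMod ℓ₄) * a ^ 3 * b + (n : ZMod ℓ₄) * b ^ 4 ≠ 0)
    {Q m : ℕ} (hQ : Q ≠ 0) (hQm : ¬ 2 ^ (m + 1) ∣ Q)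
    (hmod : nonempty_modularParametrizationData)
    (hGZK : rank_eq_analyticRank_of_analyticRank_le_one)
    (h124 : Kato2004.thm12_4) (hX0 : Kato2004_fineSelmerDual_isTorsion)
    (hDD : DokchitserDokchitser2012_surjective_mod_two_four_eight) :
    ∀ (W : WeierstrassCurve ℚ) [W.IsElliptic] [W.IsGloballyMinimal], W = M.baseChange ℚ →
    ∀ (κ : ZpExtension ℚ 2) (γ : Field.absoluteGaloisGroup ℚ), κ.IsCyclotomic → κ.IsTopGenerator γ →
    ∀ (v : HeightOneSpectrum (𝓞 ℚ)), (2 : 𝓞 ℚ) ∈ v.asIdeal →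
    ∀ (g : Field.absoluteGaloisGroup (v.adicCompletion ℚ)) (c : ℕ → localPoints W (v.adicCompletion ℚ)),
      κ.IsTopGenerator (resGalOfEmb (closureEmb (K := ℚ) (v.adicCompletion ℚ)) g) →
    (∀ n, c n ∈ localLayerPointsOfEmb κ (closureEmb (K := ℚ) (v.adicCompletion ℚ)) W n) →
    (∀ n, 1 ≤ n → localTraceOfEmb κ (closureEmb (K := ℚ) (v.adicCompletion ℚ)) W n (n + 1)
      (c (n + 1)) = W.frobeniusTrace 2 • c n - c (n - 1)) →
    (∀ z₀ : localLayerPointsOfEmb κ (closureEmb (K := ℚ) (v.adicCompletion ℚ)) W 0 →+ ℤ_[2],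
      evalOn W (localLayerPointsOfEmb κ (closureEmb (K := ℚ) (v.adicCompletion ℚ)) W 0) z₀ (c 0) = 0 →
        z₀ = 0) →
    (∀ a : ℤ_[2],
      (∃ z₀ : localLayerPointsOfEmb κ (closureEmb (K := ℚ) (v.adicCompletion ℚ)) W 0 →+ ℤ_[2],
        evalOn W (localLayerPointsOfEmb κ (closureEmb (K := ℚ) (v.adicCompletion ℚ)) W 0) z₀ (c 0) =
          2 * a) →
      ∃ y : localLayerPointsOfEmb κ (closureEmb (K := ℚ) (v.adicCompletion ℚ)) W 0 →+ ℤ_[2],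
        evalOn W (localLayerPointsOfEmb κ (closureEmb (K := ℚ) (v.adicCompletion ℚ)) W 0) y (c 0) = a) →
    (Finite (W.selmerGroupPInfty 2) →
      Finite (EndCoinvariants (conjSharpFlatSelmerInfty W κ (closureEmb (K := ℚ) (v.adicCompletion ℚ))
        (W.frobeniusTrace 2) g c .flat γ - 1)) →
      Nat.card (↥((sharpFlatSelmerInfty W κ (closureEmb (K := ℚ) (v.adicCompletion ℚ))
            (W.frobeniusTrace 2) g c .flat).comap (W.layerToInfty κ 0)) ⧸
          (W.selmerLayer κ 0).addSubgroupOf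
            ((sharpFlatSelmerInfty W κ (closureEmb (K := ℚ) (v.adicCompletion ℚ))
              (W.frobeniusTrace 2) g c .flat).comap (W.layerToInfty κ 0))) *
        Nat.card (MulAction.fixedPoints (Field.absoluteGaloisGroup ℚ) (W.geomPrimaryTorsion 2)) =
      2 ^ (padicValNat 2 W.tamagawaProduct) *
        Nat.card (EndCoinvariants (conjSharpFlatSelmerInfty W κ
          (closureEmb (K := ℚ) (v.adicCompletion ℚ)) (W.frobeniusTrace 2) g c .flat γ - 1))) →
    (∀ [NeZero (W.conductorNorm ℤ)] (f : CuspForm (Gamma0 (W.conductorNorm ℤ)) 2),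
        IsNewformOf W f → ∀ (ϖ : ℚ), (ϖ : ℝ) * W.realPeriodRat = plusPeriod f →
      ∀ (Ls Lf : IwasawaAlgebra 2), IsSprungPair f 2 (W.frobeniusTrace 2) Ls Lf →
      ∀ (D : SharpFlatSelmerDualData W κ γ (closureEmb (K := ℚ) (v.adicCompletion ℚ))
          (W.frobeniusTrace 2) g c .flat)
        [ContinuousSMul ℤ_[2] (W.tateModule 2)],
        ∃ (I : Kato2004.IwasawaH1Data W 2 κ γ) (Y : W.FineSelmerDualData κ γ)
          (P : Submodule (IwasawaAlgebra 2) (IwasawaAlgebra 2))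
          (loc : I.H →ₗ[IwasawaAlgebra 2] P) (toX : P →ₗ[IwasawaAlgebra 2] D.X)
          (δ : D.X →ₗ[IwasawaAlgebra 2] Y.X) (Z : Submodule (IwasawaAlgebra 2) I.H)
          (G : IwasawaAlgebra 2),
          Function.Exact loc toX ∧ Function.Exact toX δ ∧
          G ∈ Submodule.map (P.subtype ∘ₗ loc) Z ∧
          iwasawaToPowerSeries 2 G = PowerSeries.C (ϖ : ℚ_[2]) * iwasawaToPowerSeries 2 Lf ∧
          (∀ 𝔭 : PrimeSpectrum (IwasawaAlgebra 2), 𝔭.asIdeal.height = 1 →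
            PowerSeries.C (2 : ℤ_[2]) ∉ 𝔭.asIdeal →
            Literature.NumberTheory.EllipticCurves.Module.lengthAt (IwasawaAlgebra 2) Y.X 𝔭 ≤
              Literature.NumberTheory.EllipticCurves.Module.lengthAt (IwasawaAlgebra 2) (I.H ⧸ Z) 𝔭) ∧
          (TwoAdicSurjective W →
            ∀ 𝔭 : PrimeSpectrum (IwasawaAlgebra 2), 𝔭.asIdeal.height = 1 →
              PowerSeries.C (2 : ℤ_[2]) ∈ 𝔭.asIdeal →
              Literature.NumberTheory.EllipticCurves.Module.lengthAt (IwasawaAlgebra 2) Y.X 𝔭 ≤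
                Literature.NumberTheory.EllipticCurves.Module.lengthAt (IwasawaAlgebra 2) (I.H ⧸ Z) 𝔭)) →
    W.entireLFunction 1 ≠ 0 → shaAn W = ((Q : ℚ) : ℂ) → 2 ^ m ∣ W.shaOrder → BSDp W 2 := by
  intro W _ _ hW κ γ hκ hγ v hv g c hg hc hTr hinj hsat hcount hCK hL hq hdvd
  subst hW
  obtain ⟨hgood, ha, hss⟩ := goodSS_two_baseChange_int_of_card M (by rwa [hΔ]) hcard hk
  exact bsdp_two_of_flatCountColemanKato_of_pow_dvd _ g c hmod hGZK h124 hX0 hgood hss.2 hL hκ hγ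
    (SSColemanRoad.twoAdicSurjective_baseChange_int_of_certificates M hDD hb₂ hb₄ hb₆ hΔ hc₄ hd hnd hℓ₄
      h₁ h₂ h₃ h₄)
    hv hg hc hTr hinj hsat hcount hCK hq (SSColemanRoad.padicValRat_two_natCast_le hQ hQm) hdvd

/-! ## §3 The class `100925b` in the new currency -/

/-- **`BSD(100925b1, 2)` ON THE ♭ COLEMAN ROAD, EC♭ DISCHARGED** — the class instance of crux
`SupersingularRankZeroAtTwo` at the class `100925b` (`a₂ = 2`; `100925b1 = [0, 1, 1, −213157158, 17550889390969]`,
`N = 100925`) re-displayed with the ♭ `Γ`-Euler characteristic at `2` PRODUCED: displayed PRINT {`hmod`, `hGZK`,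
`h124`, `hX0`, `hDD`}; for the supplied `(κ, γ, v ∋ 2, g, c)`: {levels, trace (`n ≥ 1`), gen₀(`c_0`)} (Sprung
2012 Thm. 2.2 (2′) traced / derived), READ-AT-2 {COUNT♭@2, CK♭@2}; CERT {`L(E,1) ≠ 0`, `#Ш_an = 16`, `2^4 ∣ #Ш`}.
KERNEL (from the landed class file `…FlatClass100925b.lean`): `Δ`, `c₄`, `b`'s, `2 ∤ Δ`, `#Ẽ(𝔽₂) = 1`,
`j` not integral, DD certificates `ℓ = 3, 3, 4, 7`, `2^5 ∤ 16`. Closes nothing by itself.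
[cite: Sprung2012, Thm. 2.2, Thm. 7.14, 7.16 and Prop. 7.19] [cite: Sprung2024, §5.2 Lemmas 5.5–5.9]
[cite: Kato2004Asterisque, Thm. 12.4–12.5] [cite: KuriharaOtsuki2006, p. 564] [cite: DokchitserDokchitserMathZ2012, Theorem]
[cite: CremonaAlgorithms1997, Table 1] [cite: Miller2011LMS, Def. 1.1] -/
theorem bsdp_two_100925b1_of_flatCountColemanKato
    (hmod : nonempty_modularParametrizationData)
    (hGZK : rank_eq_analyticRank_of_analyticRank_le_one)
    (h124 : Kato2004.thm12_4) (hX0 : Kato2004_fineSelmerDual_isTorsion)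
    (hDD : DokchitserDokchitser2012_surjective_mod_two_four_eight) :
    ∀ (W : WeierstrassCurve ℚ) [W.IsElliptic] [W.IsGloballyMinimal],
      W = (⟨0, 1, 1, -213157158, 17550889390969⟩ : WeierstrassCurve ℤ).baseChange ℚ →
    ∀ (κ : ZpExtension ℚ 2) (γ : Field.absoluteGaloisGroup ℚ), κ.IsCyclotomic → κ.IsTopGenerator γ →
    ∀ (v : HeightOneSpectrum (𝓞 ℚ)), (2 : 𝓞 ℚ) ∈ v.asIdeal →
    ∀ (g : Field.absoluteGaloisGroup (v.adicCompletion ℚ)) (c : ℕ → localPoints W (v.adicCompletion ℚ)),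
      κ.IsTopGenerator (resGalOfEmb (closureEmb (K := ℚ) (v.adicCompletion ℚ)) g) →
    (∀ n, c n ∈ localLayerPointsOfEmb κ (closureEmb (K := ℚ) (v.adicCompletion ℚ)) W n) →
    (∀ n, 1 ≤ n → localTraceOfEmb κ (closureEmb (K := ℚ) (v.adicCompletion ℚ)) W n (n + 1)
      (c (n + 1)) = W.frobeniusTrace 2 • c n - c (n - 1)) →
    (∀ z₀ : localLayerPointsOfEmb κ (closureEmb (K := ℚ) (v.adicCompletion ℚ)) W 0 →+ ℤ_[2],
      evalOn W (localLayerPointsOfEmb κ (closureEmb (K := ℚ) (v.adicCompletion ℚ)) W 0) z₀ (c 0) = 0 →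
        z₀ = 0) →
    (∀ a : ℤ_[2],
      (∃ z₀ : localLayerPointsOfEmb κ (closureEmb (K := ℚ) (v.adicCompletion ℚ)) W 0 →+ ℤ_[2],
        evalOn W (localLayerPointsOfEmb κ (closureEmb (K := ℚ) (v.adicCompletion ℚ)) W 0) z₀ (c 0) =
          2 * a) →
      ∃ y : localLayerPointsOfEmb κ (closureEmb (K := ℚ) (v.adicCompletion ℚ)) W 0 →+ ℤ_[2],
        evalOn W (localLayerPointsOfEmb κ (closureEmb (K := ℚ) (v.adicCompletion ℚ)) W 0) y (c 0) = a) →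
    (Finite (W.selmerGroupPInfty 2) →
      Finite (EndCoinvariants (conjSharpFlatSelmerInfty W κ (closureEmb (K := ℚ) (v.adicCompletion ℚ))
        (W.frobeniusTrace 2) g c .flat γ - 1)) →
      Nat.card (↥((sharpFlatSelmerInfty W κ (closureEmb (K := ℚ) (v.adicCompletion ℚ))
            (W.frobeniusTrace 2) g c .flat).comap (W.layerToInfty κ 0)) ⧸
          (W.selmerLayer κ 0).addSubgroupOf
            ((sharpFlatSelmerInfty W κ (closureEmb (K := ℚ) (v.adicCompletion ℚ))
              (W.frobeniusTrace 2) g c .flat).comap (W.layerToInfty κ 0))) *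
        Nat.card (MulAction.fixedPoints (Field.absoluteGaloisGroup ℚ) (W.geomPrimaryTorsion 2)) =
      2 ^ (padicValNat 2 W.tamagawaProduct) *
        Nat.card (EndCoinvariants (conjSharpFlatSelmerInfty W κ
          (closureEmb (K := ℚ) (v.adicCompletion ℚ)) (W.frobeniusTrace 2) g c .flat γ - 1))) →
    (∀ [NeZero (W.conductorNorm ℤ)] (f : CuspForm (Gamma0 (W.conductorNorm ℤ)) 2),
        IsNewformOf W f → ∀ (ϖ : ℚ), (ϖ : ℝ) * W.realPeriodRat = plusPeriod f →
      ∀ (Ls Lf : IwasawaAlgebra 2), IsSprungPair f 2 (W.frobeniusTrace 2) Ls Lf →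
      ∀ (D : SharpFlatSelmerDualData W κ γ (closureEmb (K := ℚ) (v.adicCompletion ℚ))
          (W.frobeniusTrace 2) g c .flat)
        [ContinuousSMul ℤ_[2] (W.tateModule 2)],
        ∃ (I : Kato2004.IwasawaH1Data W 2 κ γ) (Y : W.FineSelmerDualData κ γ)
          (P : Submodule (IwasawaAlgebra 2) (IwasawaAlgebra 2))
          (loc : I.H →ₗ[IwasawaAlgebra 2] P) (toX : P →ₗ[IwasawaAlgebra 2] D.X)
          (δ : D.X →ₗ[IwasawaAlgebra 2] Y.X) (Z : Submodule (IwasawaAlgebra 2) I.H)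
          (G : IwasawaAlgebra 2),
          Function.Exact loc toX ∧ Function.Exact toX δ ∧
          G ∈ Submodule.map (P.subtype ∘ₗ loc) Z ∧
          iwasawaToPowerSeries 2 G = PowerSeries.C (ϖ : ℚ_[2]) * iwasawaToPowerSeries 2 Lf ∧
          (∀ 𝔭 : PrimeSpectrum (IwasawaAlgebra 2), 𝔭.asIdeal.height = 1 →
            PowerSeries.C (2 : ℤ_[2]) ∉ 𝔭.asIdeal →
            Literature.NumberTheory.EllipticCurves.Module.lengthAt (IwasawaAlgebra 2) Y.X 𝔭 ≤
              Literature.NumberTheory.EllipticCurves.Module.lengthAt (IwasawaAlgebra 2) (I.H ⧸ Z) 𝔭) ∧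
          (TwoAdicSurjective W →
            ∀ 𝔭 : PrimeSpectrum (IwasawaAlgebra 2), 𝔭.asIdeal.height = 1 →
              PowerSeries.C (2 : ℤ_[2]) ∈ 𝔭.asIdeal →
              Literature.NumberTheory.EllipticCurves.Module.lengthAt (IwasawaAlgebra 2) Y.X 𝔭 ≤
                Literature.NumberTheory.EllipticCurves.Module.lengthAt (IwasawaAlgebra 2) (I.H ⧸ Z) 𝔭)) →
    W.entireLFunction 1 ≠ 0 → shaAn W = ((16 : ℕ) : ℚ) → 2 ^ 4 ∣ W.shaOrder → BSDp W 2 :=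
  bsdp_two_baseChange_int_of_flatCountColemanKato _ M100925b1_b.1 M100925b1_b.2.1 M100925b1_b.2.2 M100925b1_Δ
    M100925b1_c₄ (by decide) card_F2_100925b1 (by decide) (n := -68549367473797785574518784)
    (d := 8476915429920173201796875) (by decide) (by norm_num)
    (ℓ₁ := 3) (ℓ₂ := 3) (ℓ₃ := 4) (ℓ₄ := 7) (by norm_num)
    (by decide) (by decide) (by decide) (by decide) (Q := 16) (m := 4) (by decide) (by decide)
    hmod hGZK h124 hX0 hDD

end SSFlatRoad
end Summit.BirchSwinnertonDyer.BirchSwinnertonDyer.Theorems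

end
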